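import Mathlib
import Literature.Analysis.FluidPDE.Tao2016AveragedNS.ShiftSetCascadeFlows
import Literature.Analysis.FluidPDE.Tao2016AveragedNS.ShiftSetCascadeFlux
import Summits.NavierStokesRegularity.NavierStokesRegularity.Theorems.TaoLadderRungTwoFlatQuadPolarOn
import Summits.NavierStokesRegularity.NavierStokesRegularity.Theorems.TaoLadderRungTwoFlatLinearisedUniqueness
import Summits.NavierStokesRegularity.NavierStokesRegularity.Theorems.TaoLadderRungTwoFlatPulseDefs
import Summits.NavierStokesRegularity.NavierStokesRegularity.Theorems.TaoLadderRungTwoFlatGaugeGronwall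
import Summits.NavierStokesRegularity.NavierStokesRegularity.Theorems.TaoLadderRungTwoFlatNonlinearHop
import HarnessLib

/-!
# RE-NORMALISATION after a hop: the neutral coefficients `c₁` (phase) and `c₂` (scale) of the linear ⇒ nonlinear hop
  estimate are absorbed by a member `κ·W(· + h)` of the reference family, to second order
  (helper for item stmt-NavierStokesRegularity-22987 `FlatGapCertificatesV2`, crux K_A♭ of route TaoLadderRungTwoFlat;
  cell harvest/h2-tao-ladder, p1 g20 — lemma L3 «linear ⇒ nonlinear validated hop» of the analytic lane, second half:
  LADDER §47.3 «IFT in (τ₁, a)», here in closed form `κ = 1 + c₂`, `h = c₁/κ`)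

`…NonlinearHop.nonlinear_hop_estimate` leaves the deviation after the hop within `ρB + (quadratic)` of the span of the
phase direction `Ẇ(T) = Q(W)(T)` and the scale direction `W(T)` (coefficients `|c₁|, |c₂| ≤ CB`). Since
`(1 + c₂)W(T) + c₁Ẇ(T) = κ(W(T) + hẆ(T))` with `κ = 1 + c₂`, `h = c₁/κ`, and `W(T) + hẆ(T) = W(T + h) + O(h²Ẅ)`, the
hop lands within `ρB + O(B² + B̃²)` (in the contraction gauge `ω`) of the STATE AT TIME `T + h` OF THE RESCALED REFERENCE
`κW` — an honest trajectory of the scale family (`FlowSymmetry.scaleFam`, up to time reparametrisation), so the estimate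
iterates along itineraries. The `O(h²)` Taylor term is controlled IN THE GAUGE through a gauge bound on the reference
near the read-out time (`w|W| ≤ M_w` on `[T−1, T+1]`, e.g. the doubly-exponential leading edge of a pulse):

* `abs_taylor_two_le` — `|f(T+h) − f(T) − h f'(T)| ≤ G h²` when `f'` is `G`-Lipschitz around `T` (mean value, twice);
* `gauge_abs_accel_le` — `w|Ẅ| = w|Lin_W(Q(W))| ≤ 2‖α‖₁²A²M_w³` from `w|W| ≤ M_w` (admissible gauge);
* `hop_renormalisation` — **∃ κ h, |κ − 1| ≤ CB, |h| ≤ 2CB, and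
  `ω_{i,k}|X_{i,k+N}(T) − κ·W_{i,k+N}(T + h)| ≤ ρB + Γ(‖α‖₁A(B̃e^{L'T})²Te^{L'T} + 12 C²B² ‖α‖₁²A²M_w³)`**
  under the hypotheses of `nonlinear_hop_estimate` with the (S2) directions, `CB ≤ 1/2`, and the gauge bound on `W`.

HONEST FRAMING: elementary perturbation theory for MODEL lattices; no pulse is constructed, nothing is certified, nothing
here is a statement about the Navier–Stokes equations.
-/

noncomputable section

-- the sub-problem namespace repeats the summit name by design (D-0017)
set_option linter.dupNamespace false

namespace Summit.NavierStokesRegularity.NavierStokesRegularity.Theorems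

open Set Filter Literature.Analysis.FluidPDE Literature.Analysis.FluidPDE.TaoCascade
open scoped Topology Nat

namespace QuadPolar

variable {m : ℕ}

/-! ### A second-order Taylor bound -/

/-- **Second-order Taylor bound from a Lipschitz derivative**: if `f` has derivative `f'` everywhere and
`|f'(s) − f'(T)| ≤ G|s − T|` for `s ∈ [T − |h|, T + |h|]` (`G ≥ 0`), then `|f(T + h) − f(T) − h·f'(T)| ≤ G h²`. [folklore] -/
theorem abs_taylor_two_le {f f' : ℝ → ℝ} {T h G : ℝ} (hG : 0 ≤ G) (hf : ∀ s, HasDerivAt f (f' s) s)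
    (hlip : ∀ s ∈ Icc (T - |h|) (T + |h|), |f' s - f' T| ≤ G * |s - T|) :
    |f (T + h) - f T - h * f' T| ≤ G * h ^ 2 := by
  -- g(s) = f(s) − s f'(T) has derivative f'(s) − f'(T), bounded by G|h| on the segment
  have hseg : ∀ s ∈ uIcc T (T + h), s ∈ Icc (T - |h|) (T + |h|) := by
    intro s hs
    rcases le_or_gt 0 h with hh | hh
    · rw [uIcc_of_le (by linarith)] at hs
      rw [abs_of_nonneg hh]
      exact ⟨by linarith [hs.1], hs.2⟩
    · rw [uIcc_of_ge (by linarith)] at hs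
      rw [abs_of_neg hh]
      exact ⟨by linarith [hs.1], by linarith [hs.2]⟩
  have hder : ∀ s ∈ uIcc T (T + h),
      HasDerivWithinAt (fun s => f s - s * f' T) (f' s - f' T) (uIcc T (T + h)) s := by
    intro s _
    have h1 : HasDerivAt (fun s => f s - s * f' T) (f' s - 1 * f' T) s :=
      (hf s).sub ((hasDerivAt_id s).mul_const _)
    rw [one_mul] at h1
    exact h1.hasDerivWithinAt
  have hbound : ∀ s ∈ uIcc T (T + h), ‖f' s - f' T‖ ≤ G * |h| := by
    intro s hs
    have hs' := hseg s hs
    have hsT : |s - T| ≤ |h| := by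
      rw [abs_le]; constructor <;> linarith [hs'.1, hs'.2]
    rw [Real.norm_eq_abs]
    exact (hlip s hs').trans (mul_le_mul_of_nonneg_left hsT hG)
  have hmv := Convex.norm_image_sub_le_of_norm_hasDerivWithin_le hder hbound (convex_uIcc T (T + h))
    left_mem_uIcc right_mem_uIcc
  have e : (f (T + h) - (T + h) * f' T) - (f T - T * f' T) = f (T + h) - f T - h * f' T := by ring
  rw [e, Real.norm_eq_abs] at hmv
  calc |f (T + h) - f T - h * f' T| ≤ G * |h| * ‖T + h - T‖ := hmv
    _ = G * h ^ 2 := by rw [add_sub_cancel_left, Real.norm_eq_abs, mul_assoc, ← sq, sq_abs]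

/-! ### The acceleration of the reference in the gauge -/

/-- **Gauge bound on the acceleration of an exact solution**: if `w|W(t)| ≤ M_w` at all sites at time `t` (admissible
gauge, constant `A`), then `w_{i,n}|Ẅ_{i,n}(t)| = w_{i,n}|Lin_W(Q(W))_{i,n}(t)| ≤ 2‖α‖₁²A²M_w³`.
[cite: Tao2016AveragedNS, §4 (4.8); folklore estimate] -/
theorem gauge_abs_accel_le {𝕊 : Finset (ℤ × ℤ × ℤ)} (h𝕊 : IsNearestNeighbourSet 𝕊)
    (α : Fin m → Fin m → Fin m → ℤ × ℤ × ℤ → ℝ) {w : Fin m → ℤ → ℝ} {A : ℝ} (hwpos : ∀ i n, 0 < w i n)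
    (hA : IsWindowAdmissible w A) {W : Fin m → ℤ → ℝ → ℝ} {Mw t : ℝ} (hMw : 0 ≤ Mw)
    (hWg : ∀ j k, w j k * |W j k t| ≤ Mw) (i : Fin m) (n : ℤ) :
    w i n * |linTermOn 𝕊 0 α W (fun j k s => quadTermOn 𝕊 0 α W j k s) i n t| ≤
      2 * (tableAbsSum 𝕊 α) ^ 2 * A ^ 2 * Mw ^ 3 := by
  have hQ : ∀ j k, w j k * |quadTermOn 𝕊 0 α W j k t| ≤ tableAbsSum 𝕊 α * A * Mw ^ 2 := fun j k =>
    gauge_abs_quadTermOn_le h𝕊 α hwpos hA hMw fun j' k' _ => hWg j' k'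
  have hc : 0 ≤ tableAbsSum 𝕊 α * A * Mw ^ 2 := by have := tableAbsSum_nonneg 𝕊 α; have := hA.1; positivity
  unfold linTermOn
  have h1 := gauge_abs_bilinOn_le h𝕊 α hwpos hA (X := W) (Y := fun j k s => quadTermOn 𝕊 0 α W j k s) hMw hc
    (i := i) (n := n) (t := t) (fun j k _ => hWg j k) (fun j k _ => hQ j k)
  have h2 := gauge_abs_bilinOn_le h𝕊 α hwpos hA (X := fun j k s => quadTermOn 𝕊 0 α W j k s) (Y := W) hc hMw
    (i := i) (n := n) (t := t) (fun j k _ => hQ j k) (fun j k _ => hWg j k)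
  have hw0 : 0 < w i n := hwpos i n
  calc w i n * |bilinOn 𝕊 0 α W (fun j k s => quadTermOn 𝕊 0 α W j k s) i n t +
        bilinOn 𝕊 0 α (fun j k s => quadTermOn 𝕊 0 α W j k s) W i n t|
      ≤ w i n * (|bilinOn 𝕊 0 α W (fun j k s => quadTermOn 𝕊 0 α W j k s) i n t| +
          |bilinOn 𝕊 0 α (fun j k s => quadTermOn 𝕊 0 α W j k s) W i n t|) :=
        mul_le_mul_of_nonneg_left (abs_add_le _ _) hw0.le
    _ ≤ tableAbsSum 𝕊 α * A * Mw * (tableAbsSum 𝕊 α * A * Mw ^ 2) +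
          tableAbsSum 𝕊 α * A * (tableAbsSum 𝕊 α * A * Mw ^ 2) * Mw := by rw [mul_add]; exact add_le_add h1 h2
    _ = 2 * (tableAbsSum 𝕊 α) ^ 2 * A ^ 2 * Mw ^ 3 := by ring

/-- **Gauge Taylor bound for the reference**: with `w|W| ≤ M_w` on `[T − 1, T + 1]` and `|h| ≤ 1`,
`w_{i,n}|W_{i,n}(T + h) − W_{i,n}(T) − h·Q(W)_{i,n}(T)| ≤ 2‖α‖₁²A²M_w³·h²`. [cite: Tao2016AveragedNS, §4 (4.8); folklore] -/
theorem gauge_abs_taylor_le {𝕊 : Finset (ℤ × ℤ × ℤ)} (h𝕊 : IsNearestNeighbourSet 𝕊)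
    (α : Fin m → Fin m → Fin m → ℤ × ℤ × ℤ → ℝ) {w : Fin m → ℤ → ℝ} {A : ℝ} (hwpos : ∀ i n, 0 < w i n)
    (hA : IsWindowAdmissible w A) {W : Fin m → ℤ → ℝ → ℝ} {Mw T h : ℝ} (hMw : 0 ≤ Mw)
    (hW : ∀ i n t, HasDerivAt (W i n) (quadTermOn 𝕊 0 α W i n t) t)
    (hWg : ∀ j k, ∀ t ∈ Icc (T - 1) (T + 1), w j k * |W j k t| ≤ Mw) (hh : |h| ≤ 1) (i : Fin m) (n : ℤ) :
    w i n * |W i n (T + h) - W i n T - h * quadTermOn 𝕊 0 α W i n T| ≤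
      2 * (tableAbsSum 𝕊 α) ^ 2 * A ^ 2 * Mw ^ 3 * h ^ 2 := by
  have hw0 : 0 < w i n := hwpos i n
  set G : ℝ := 2 * (tableAbsSum 𝕊 α) ^ 2 * A ^ 2 * Mw ^ 3 with hG
  have hG0 : 0 ≤ G := by rw [hG]; have := hA.1; positivity
  -- Ẇ = Q(W) has derivative Lin_W(Q(W)), gauge-bounded by G on [T-1, T+1]
  have hQd : ∀ s, HasDerivAt (fun s => quadTermOn 𝕊 0 α W i n s)
      (linTermOn 𝕊 0 α W (fun j k s => quadTermOn 𝕊 0 α W j k s) i n s) s := fun s =>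
    MirrorPulse.hasDerivAt_quadTermOn 𝕊 0 α (fun j k => hW j k s) i n
  have hlipQ : ∀ s ∈ Icc (T - |h|) (T + |h|),
      |quadTermOn 𝕊 0 α W i n s - quadTermOn 𝕊 0 α W i n T| ≤ G / w i n * |s - T| := by
    intro s hs
    have hsub : uIcc T s ⊆ Icc (T - 1) (T + 1) := by
      intro x hx
      rcases le_or_gt T s with hTs | hTs
      · rw [uIcc_of_le hTs] at hx; exact ⟨by linarith [hx.1], by linarith [hx.2, hs.2]⟩
      · rw [uIcc_of_ge hTs.le] at hx; exact ⟨by linarith [hx.1, hs.1], by linarith [hx.2]⟩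
    have hb : ∀ x ∈ uIcc T s, ‖linTermOn 𝕊 0 α W (fun j k s => quadTermOn 𝕊 0 α W j k s) i n x‖ ≤ G / w i n := by
      intro x hx
      rw [Real.norm_eq_abs, le_div_iff₀ hw0, mul_comm]
      exact gauge_abs_accel_le h𝕊 α hwpos hA hMw (fun j k => hWg j k x (hsub hx)) i n
    have h := Convex.norm_image_sub_le_of_norm_hasDerivWithin_le (fun x _ => (hQd x).hasDerivWithinAt) hb
      (convex_uIcc T s) left_mem_uIcc right_mem_uIcc
    rw [Real.norm_eq_abs, Real.norm_eq_abs] at h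
    exact h
  have ht := abs_taylor_two_le (f := W i n) (f' := fun s => quadTermOn 𝕊 0 α W i n s) (by positivity) (hW i n) hlipQ
  calc w i n * |W i n (T + h) - W i n T - h * quadTermOn 𝕊 0 α W i n T| ≤ w i n * (G / w i n * h ^ 2) :=
        mul_le_mul_of_nonneg_left ht hw0.le
    _ = G * h ^ 2 := by field_simp

/-! ### Re-normalisation -/

/-- **HOP RE-NORMALISATION (L3, second half).** Under the hypotheses of `nonlinear_hop_estimate` with the (S2) directions
`v₁ = Q(W)_{·+N}(T)` (phase) and `v₂ = W_{·+N}(T)` (scale), `CB ≤ 1/2`, and a gauge bound `w|W| ≤ M_w` on `[T−1, T+1]`: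
there are `κ = 1 + c₂` and `h = c₁/κ` with `|κ − 1| ≤ CB`, `|h| ≤ 2CB`, such that
`ω_{i,k}|X_{i,k+N}(T) − κ·W_{i,k+N}(T + h)| ≤ ρB + Γ(‖α‖₁A(B̃e^{L'T})²Te^{L'T} + 12C²B²‖α‖₁²A²M_w³)`: after the hop
the perturbed solution is, in the contraction gauge, within `ρB + O(B² + B̃²)` of an honest state of the rescaled
reference family. [cite: Tao2016AveragedNS, §4 (4.8) and §6.3–6.4 (statement shape); route TaoLadderRungTwoFlat, analytic lane L3] -/
theorem hop_renormalisation {𝕊 : Finset (ℤ × ℤ × ℤ)} (h𝕊 : IsNearestNeighbourSet 𝕊)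
    (α : Fin m → Fin m → Fin m → ℤ × ℤ × ℤ → ℝ) {w ω : Fin m → ℤ → ℝ} {Λ A Γ : ℝ} (hw : IsWindowRegular w Λ)
    (hA : IsWindowAdmissible w A) (hω : ∀ i k, 0 ≤ ω i k) {N : ℤ} (hΓ : ∀ i k, ω i k ≤ Γ * w i (k + N))
    {W X : Fin m → ℤ → ℝ → ℝ} {M Mw T ρ C B B' : ℝ} (hT : 0 ≤ T) (hMw : 0 ≤ Mw)
    (hW : ∀ i n t, HasDerivAt (W i n) (quadTermOn 𝕊 0 α W i n t) t)
    (hX : ∀ i n t, HasDerivAt (X i n) (quadTermOn 𝕊 0 α X i n t) t)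
    (hWb : ∀ i n t, |W i n t| ≤ M) (hXb : ∀ i n t, |X i n t| ≤ M)
    (hWg : ∀ j k, ∀ t ∈ Icc (T - 1) (T + 1), w j k * |W j k t| ≤ Mw)
    (hlin : ∀ u : Fin m → ℤ → ℝ → ℝ, (∀ i n t, HasDerivAt (u i n) (linTermOn 𝕊 0 α W u i n t) t) →
      (∃ Mu : ℝ, ∀ i n, ∀ t ∈ Icc 0 T, |u i n t| ≤ Mu) → (∀ i k, ω i k * |u i k 0| ≤ B) →
        ∃ c₁ c₂ : ℝ, |c₁| ≤ C * B ∧ |c₂| ≤ C * B ∧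
          ∀ i k, ω i k * |u i (k + N) T - c₁ * quadTermOn 𝕊 0 α W i (k + N) T - c₂ * W i (k + N) T| ≤ ρ * B)
    (hB : ∀ i k, ω i k * |X i k 0 - W i k 0| ≤ B) (hB' : ∀ i k, w i k * |X i k 0 - W i k 0| ≤ B')
    (hCB : C * B ≤ 1 / 2) :
    ∃ κ h : ℝ, |κ - 1| ≤ C * B ∧ |h| ≤ 2 * (C * B) ∧
      ∀ i k, ω i k * |X i (k + N) T - κ * W i (k + N) (T + h)| ≤
        ρ * B + Γ * (tableAbsSum 𝕊 α * A * (B' * Real.exp (2 * tableAbsSum 𝕊 α * M * Λ * T)) ^ 2 * T *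
          Real.exp (2 * tableAbsSum 𝕊 α * M * Λ * T) + 12 * (C * B) ^ 2 * ((tableAbsSum 𝕊 α) ^ 2 * A ^ 2 * Mw ^ 3)) := by
  obtain ⟨c₁, c₂, hc₁, hc₂, hest⟩ := nonlinear_hop_estimate h𝕊 α hw hA hω hΓ hT hW hX hWb hXb
    (v₁ := fun i k => quadTermOn 𝕊 0 α W i (k + N) T) (v₂ := fun i k => W i (k + N) T) hlin hB hB'
  set κ : ℝ := 1 + c₂ with hκ
  have hc₂' : |c₂| ≤ 1 / 2 := hc₂.trans hCB
  have hκlo : 1 / 2 ≤ κ := by rw [hκ]; linarith [(abs_le.mp hc₂').1]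
  have hκhi : κ ≤ 3 / 2 := by rw [hκ]; linarith [(abs_le.mp hc₂').2]
  have hκpos : 0 < κ := by linarith
  set h : ℝ := c₁ / κ with hh
  have hhabs : |h| ≤ 2 * (C * B) := by
    rw [hh, abs_div, abs_of_pos hκpos, div_le_iff₀ hκpos]
    nlinarith [hc₁, abs_nonneg c₁]
  have hh1 : |h| ≤ 1 := hhabs.trans (by linarith)
  refine ⟨κ, h, by rw [hκ]; simpa using hc₂, hhabs, fun i k => ?_⟩
  set E₁ : ℝ := tableAbsSum 𝕊 α * A * (B' * Real.exp (2 * tableAbsSum 𝕊 α * M * Λ * T)) ^ 2 * T *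
    Real.exp (2 * tableAbsSum 𝕊 α * M * Λ * T) with hE₁
  set G : ℝ := (tableAbsSum 𝕊 α) ^ 2 * A ^ 2 * Mw ^ 3 with hG
  have hwpos := hw.1
  have hw0 : 0 < w i (k + N) := hwpos i (k + N)
  have hΓ0 : 0 ≤ Γ := by
    have h1 := (hω i k).trans (hΓ i k)
    by_contra hneg
    push Not at hneg
    have : Γ * w i (k + N) < 0 := mul_neg_of_neg_of_pos hneg hw0
    linarith
  -- (1) the estimate part
  have h1 := hest i k
  -- (2) the Taylor part: κ(W(T) + hẆ(T)) − κW(T+h), in the gauge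
  have htay := gauge_abs_taylor_le h𝕊 α hwpos hA hMw hW hWg hh1 i (k + N)
  have h2 : ω i k * |κ * (W i (k + N) (T + h) - W i (k + N) T - h * quadTermOn 𝕊 0 α W i (k + N) T)| ≤
      Γ * (12 * (C * B) ^ 2 * G) := by
    rw [abs_mul, abs_of_pos hκpos]
    have hh2 : h ^ 2 ≤ (2 * (C * B)) ^ 2 := by
      have := hhabs; rw [← sq_abs]; exact pow_le_pow_left₀ (abs_nonneg _) this 2
    have hG0 : 0 ≤ G := by rw [hG]; have := hA.1; positivity
    calc ω i k * (κ * |W i (k + N) (T + h) - W i (k + N) T - h * quadTermOn 𝕊 0 α W i (k + N) T|)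
        ≤ Γ * w i (k + N) * (κ * |W i (k + N) (T + h) - W i (k + N) T - h * quadTermOn 𝕊 0 α W i (k + N) T|) :=
          mul_le_mul_of_nonneg_right (hΓ i k) (by positivity)
      _ = Γ * κ * (w i (k + N) * |W i (k + N) (T + h) - W i (k + N) T - h * quadTermOn 𝕊 0 α W i (k + N) T|) := by
          ring
      _ ≤ Γ * κ * (2 * G * h ^ 2) := by
          refine mul_le_mul_of_nonneg_left ?_ (by positivity)
          calc w i (k + N) * |W i (k + N) (T + h) - W i (k + N) T - h * quadTermOn 𝕊 0 α W i (k + N) T|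
              ≤ 2 * (tableAbsSum 𝕊 α) ^ 2 * A ^ 2 * Mw ^ 3 * h ^ 2 := htay
            _ = 2 * G * h ^ 2 := by rw [hG]; ring
      _ ≤ Γ * (3 / 2) * (2 * G * (2 * (C * B)) ^ 2) := by
          have h0 : 0 ≤ 2 * G * h ^ 2 := by positivity
          have h3 : 2 * G * h ^ 2 ≤ 2 * G * (2 * (C * B)) ^ 2 := mul_le_mul_of_nonneg_left hh2 (by positivity)
          calc Γ * κ * (2 * G * h ^ 2) ≤ Γ * (3 / 2) * (2 * G * h ^ 2) := by
                exact mul_le_mul_of_nonneg_right (mul_le_mul_of_nonneg_left hκhi hΓ0) h0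
            _ ≤ Γ * (3 / 2) * (2 * G * (2 * (C * B)) ^ 2) := mul_le_mul_of_nonneg_left h3 (by positivity)
      _ = Γ * (12 * (C * B) ^ 2 * G) := by ring
  -- (3) algebra: X − κW(T+h) = [X − W − c₁Q − c₂W] − κ[(W(T+h) − W(T) − hQ)]
  have hκh : κ * h = c₁ := by rw [hh]; field_simp
  have e : X i (k + N) T - κ * W i (k + N) (T + h) =
      (X i (k + N) T - W i (k + N) T - c₁ * quadTermOn 𝕊 0 α W i (k + N) T - c₂ * W i (k + N) T) -
        κ * (W i (k + N) (T + h) - W i (k + N) T - h * quadTermOn 𝕊 0 α W i (k + N) T) := by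
    linear_combination (-(W i (k + N) T)) * hκ + (-(quadTermOn 𝕊 0 α W i (k + N) T)) * hκh
  rw [e]
  calc ω i k * |(X i (k + N) T - W i (k + N) T - c₁ * quadTermOn 𝕊 0 α W i (k + N) T - c₂ * W i (k + N) T) -
        κ * (W i (k + N) (T + h) - W i (k + N) T - h * quadTermOn 𝕊 0 α W i (k + N) T)|
      ≤ ω i k * (|X i (k + N) T - W i (k + N) T - c₁ * quadTermOn 𝕊 0 α W i (k + N) T - c₂ * W i (k + N) T| +
          |κ * (W i (k + N) (T + h) - W i (k + N) T - h * quadTermOn 𝕊 0 α W i (k + N) T)|) :=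
        mul_le_mul_of_nonneg_left (abs_sub _ _) (hω i k)
    _ = ω i k * |X i (k + N) T - W i (k + N) T - c₁ * quadTermOn 𝕊 0 α W i (k + N) T - c₂ * W i (k + N) T| +
          ω i k * |κ * (W i (k + N) (T + h) - W i (k + N) T - h * quadTermOn 𝕊 0 α W i (k + N) T)| := by ring
    _ ≤ (ρ * B + Γ * E₁) + Γ * (12 * (C * B) ^ 2 * G) := add_le_add h1 h2
    _ = ρ * B + Γ * (E₁ + 12 * (C * B) ^ 2 * G) := by ring

end QuadPolar

end Summit.NavierStokesRegularity.NavierStokesRegularity.Theorems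

end
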